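import Mathlib
import Literature.Analysis.FluidPDE.Tao2016AveragedNS.RenormalisedCascadeWaves
import Literature.Analysis.FluidPDE.Tao2016AveragedNS.BoundedEternalSolutions
import Summits.NavierStokesRegularity.NavierStokesRegularity.Theses.TaoLadderRungTwoBreak
import Summits.NavierStokesRegularity.NavierStokesRegularity.Theorems.TaoLadderRungTwoBreakNoSurvivingEternalViscBddOneWakeDyadicClassicalConverse

/-!
# Crux `TaoLadderRungTwoBreak.NoSurvivingEternalViscBddOne` (stmt-NavierStokesRegularity-20419), stub (ρ0)
# `stub_noSurvivingEternalBddOne`, DYADIC MEMBER: the wake law is SUPERCRITICAL CASCADE REGULARITY AT THE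
# BLOW-UP TIME — any terminal regularity exponent `s > 1/5` (Onsager: `s = 1/3`) settles the dyadic slice

MODEL lattice ODEs only (Tao 2016 §1.2/§4 in the log-time variables of §6.4; the dyadic member `dyadicTable ∈ E₂(2)`
of the cell's table class); nothing in this file is a statement about the Navier–Stokes equations, and no stub, crux,
rung or summit is proved by it (`--supports stmt-NavierStokesRegularity-20419`).

DICTIONARY (tree `…WakeDyadicClassical`, `…WakeDyadicClassicalConverse`).  On the dyadic member the (ρ0)-slice
«no admissible inviscid eternal solution is forward (S₁)-surviving» is EQUIVALENT (`dyadic_noSurviving_iff_classicalPos`)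
to a classical statement on non-negative type-I ancient solutions `V` of the Katz–Pavlović / Desnianskii–Novikov chain
in critical variables `V̇_n = Λ V_{n-1}² − Λ⁻¹ V_n V_{n+1}` (`Λ = (1+ε₀)^{5/2}`): the terminal values `v_n = V_n(0⁻)`
(`= Λⁿ X_n(t⋆)`, the stranded wake in Tao's amplitudes `X`) obey `(1+ε₀)^{-4n} v_n² → 0`.  In the language of
the dyadic-model literature (`k_n = Λⁿ`, regularity classes `sup_n k_n^{s} X_n < ∞`):

  `(1+ε₀)^{-4n} v_n² = (1+ε₀)^{n} X_n(t⋆)² = (k_n^{1/5} X_n(t⋆))²`,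

so the (S₁)-survival weight is EXACTLY the regularity exponent `s = 1/5` at the blow-up time, and

* `weightedWake_le_geometric` / `tendsto_weightedWake_of_terminalRegularity` — **any exponent `s > 1/5` wins**: if
  `|v_n| ≤ C Λ^{(1-s)n}` for `n ≥ 0` (i.e. `k_n^{s}|X_n(t⋆)| ≤ C`), then `(1+ε₀)^{-4n} v_n² ≤ C² q^n` with
  `q = (1+ε₀)^{1-5s} < 1`, hence `→ 0`; the Onsager/K41 exponent `s = 1/3` (`v_n ≍ Λ^{2n/3}`, the DSS front of
  delay `θ = 5/3`) gives `q = (1+ε₀)^{-2/3}`;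
* `borderline_weightedWake_const` — the exponent `s = 1/5` itself is the BORDERLINE: `v_n = Λ^{4n/5}` has constant
  weighted wake `1` (no decay) — the (S₁) threshold is the `H^{1/2}`-type class of the chain at base `Λ`;
* `dyadic_noSurviving_of_terminalRegularity` — BY NAME: if, at scale ratio `1+ε₀`, every non-negative type-I ancient
  solution of the chain with uniformly integrable shells and shells bounded near `0⁻` has terminal values in SOME class
  `s > 1/5` (`∃ s > 1/5, ∃ C, ∀ n ≥ 0, v_n ≤ C Λ^{(1-s)n}`), then no admissible inviscid eternal solution of the dyadic
  member is forward (S₁)-surviving (the dyadic slices of (ρ0), of K1ᵛ(1) at `ν̂ = 0` and of ⟨20205⟩'s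
  `stub_eternalLiouville`).

LITERATURE PLACEMENT (presearch of this hand; what is and is not in print).  For the Cauchy problem of the same chain
with POSITIVE `ℓ²` data, supercritical cascade regularity for all `t > 0` is known at FIXED LARGE BASE only:
Barbato–Morandin (NoDEA 2013, arXiv:1201.2693, Thm. 10 ff.: `sup_n k_n^{1/3-1/(3β)} X_n(t) ≤ C t^{-1/3}`, `k_n = 2^{βn}`
— at Tao's normalisation `β = 5/2` this is exactly the borderline `s = 1/5`) and Cheskidov–Zaya (PAMS 2016,
arXiv:1310.7612, Thm. 1.1/4.2: `sup_j λ_j^{3/5} a_j(t) < ∞`, `λ_j = 2^j`, coefficient `λ_j^{5/2}` — i.e. `s = 6/25 > 1/5`,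
base `2^{5/2}`; proof by a first-crossing invariant region using the inter-shell time-scale ratio `λ^{5/2-θ} = 2^{1.9}` and
`γ = 2^{0.7}`, which degenerate to `1` as the base tends to `1`); the conjecture «exactly Onsager's regularity for all
positive time» (Cheskidov–Zaya after Thm. 1.1; Cheskidov–Dai survey JMFM 2023, arXiv:2209.10203 §3.1.4) is `s = 1/3`.
What (ρ0)|dyadic needs and is NOT in print: some `s > 1/5` UNIFORMLY as the base `Λ = (1+ε₀)^{5/2} → 1`, for TYPE-I
ANCIENT (infinite-energy) positive solutions.  HONEST LABEL: a dictionary/bookkeeping lemma (geometric sequences); the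
regularity statement itself, (ρ0), ⟨20419⟩ and every NS statement remain OPEN; rung 0.
-/

noncomputable section

-- the summit and its single sub-problem share the name (CONVENTIONS §1)
set_option linter.dupNamespace false

namespace Summit.NavierStokesRegularity.NavierStokesRegularity.Theorems.NoSurvivingEternalViscBddOne.WakeCriterion

open Filter Topology Set MeasureTheory
open Literature.Analysis.FluidPDE Literature.Analysis.FluidPDE.TaoCascade
open Summit.NavierStokesRegularity.NavierStokesRegularity.Theses.TaoLadderRungTwoBreak

section TerminalRegularity

variable {ε₀ : ℝ}

/-- `physWeight 1 ε₀ = (1+ε₀)^{-4}` as a real power. [cite: Tao2016AveragedNS, §4 (4.1), §6.4; cell vocabulary (`physWeight`)] -/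
theorem physWeight_one_rpow (hε : 0 < ε₀) : physWeight 1 ε₀ = (1 + ε₀) ^ (-4 : ℝ) := by
  have hb : (0 : ℝ) < 1 + ε₀ := by linarith
  unfold physWeight
  rw [Real.rpow_one, div_eq_mul_inv]
  have h5 : ((1 + ε₀) ^ 5 : ℝ) = (1 + ε₀) ^ (5 : ℝ) := by norm_cast
  rw [h5, ← Real.rpow_neg hb.le]
  have h1 : (1 + ε₀ : ℝ) = (1 + ε₀) ^ (1 : ℝ) := (Real.rpow_one _).symm
  conv_lhs => rw [h1, ← Real.rpow_mul hb.le, one_mul]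
  rw [← Real.rpow_add hb]
  norm_num

/-- The regularity weight in critical variables: `Λ^{(1-s)n} = (1+ε₀)^{(5/2)(1-s)n}`.
[cite: Tao2016AveragedNS, §4 (the weight `(1+ε₀)^{5n/2}`); cell vocabulary (`bigLam`)] -/
theorem bigLam_rpow_eq (hε : 0 < ε₀) (x : ℝ) : bigLam ε₀ ^ x = (1 + ε₀) ^ ((5 : ℝ) / 2 * x) := by
  have hb : (0 : ℝ) ≤ 1 + ε₀ := by linarith
  unfold bigLam
  rw [← Real.rpow_mul hb]

/-- **The weighted wake under a terminal regularity bound is geometric.**  If `|v_n| ≤ C Λ^{(1-s)n}` then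
`physWeight(1)^n v_n² ≤ C² q^n` with `q = (1+ε₀)^{1-5s}`.
[cite: Tao2016AveragedNS, §4 (4.1), §6.4; elementary] -/
theorem weightedWake_le_geometric (hε : 0 < ε₀) {s C : ℝ} {v : ℤ → ℝ}
    (hv : ∀ n : ℕ, |v n| ≤ C * bigLam ε₀ ^ ((1 - s) * n)) (n : ℕ) :
    physWeight 1 ε₀ ^ n * v n ^ 2 ≤ C ^ 2 * ((1 + ε₀) ^ (1 - 5 * s)) ^ n := by
  have hb : (0 : ℝ) < 1 + ε₀ := by linarith
  have hΛ : 0 < bigLam ε₀ := bigLam_pos (by linarith)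
  have hw0 : 0 ≤ physWeight 1 ε₀ := by rw [physWeight_one_rpow hε]; positivity
  have hpow0 : 0 ≤ C * bigLam ε₀ ^ ((1 - s) * n) := (abs_nonneg _).trans (hv n)
  -- `v_n² ≤ (C Λ^{(1-s)n})²`
  have hsq : v n ^ 2 ≤ (C * bigLam ε₀ ^ ((1 - s) * n)) ^ 2 := by
    have h := hv n
    have h' : |v n| ^ 2 ≤ (C * bigLam ε₀ ^ ((1 - s) * n)) ^ 2 :=
      pow_le_pow_left₀ (abs_nonneg _) h 2
    rwa [sq_abs] at h'
  -- the algebra of the weights: `(1+ε₀)^{-4n} Λ^{2(1-s)n} = ((1+ε₀)^{1-5s})^n`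
  have hkey : physWeight 1 ε₀ ^ n * (bigLam ε₀ ^ ((1 - s) * n)) ^ 2 = ((1 + ε₀) ^ (1 - 5 * s)) ^ n := by
    rw [physWeight_one_rpow hε, bigLam_rpow_eq hε]
    rw [← Real.rpow_mul_natCast hb.le, ← Real.rpow_mul_natCast hb.le, ← Real.rpow_mul_natCast hb.le,
      ← Real.rpow_add hb]
    congr 1
    ring
  calc physWeight 1 ε₀ ^ n * v n ^ 2
      ≤ physWeight 1 ε₀ ^ n * (C * bigLam ε₀ ^ ((1 - s) * n)) ^ 2 :=
        mul_le_mul_of_nonneg_left hsq (pow_nonneg hw0 n)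
    _ = C ^ 2 * (physWeight 1 ε₀ ^ n * (bigLam ε₀ ^ ((1 - s) * n)) ^ 2) := by ring
    _ = C ^ 2 * ((1 + ε₀) ^ (1 - 5 * s)) ^ n := by rw [hkey]

/-- **Any terminal regularity exponent `s > 1/5` gives the wake law.**  If `|v_n| ≤ C Λ^{(1-s)n}` for all `n ≥ 0`
with `s > 1/5` (in Tao's amplitudes: `k_n^{s}|X_n(t⋆)| ≤ C`, `k_n = Λⁿ`; Onsager/K41 is `s = 1/3`), then the a=1-weighted
wake tends to zero: `physWeight(1)^n v_n² → 0`.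
[cite: Tao2016AveragedNS, §4 (4.1), §6.4; Cheskidov–Zaya arXiv:1310.7612 Thm. 1.1 (the class `sup_j λ_j^{3/5} a_j`, base 2) for the shape of the hypothesis] -/
theorem tendsto_weightedWake_of_terminalRegularity (hε : 0 < ε₀) {s C : ℝ} (hs : 1 / 5 < s) {v : ℤ → ℝ}
    (hv : ∀ n : ℕ, |v n| ≤ C * bigLam ε₀ ^ ((1 - s) * n)) :
    Tendsto (fun n : ℕ => physWeight 1 ε₀ ^ n * v n ^ 2) atTop (𝓝 0) := by
  have hb1 : (1 : ℝ) < 1 + ε₀ := by linarith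
  set q : ℝ := (1 + ε₀) ^ (1 - 5 * s) with hq
  have hq0 : 0 ≤ q := by rw [hq]; positivity
  have hq1 : q < 1 := Real.rpow_lt_one_of_one_lt_of_neg hb1 (by linarith)
  have hgeom : Tendsto (fun n : ℕ => C ^ 2 * q ^ n) atTop (𝓝 0) := by
    simpa using (tendsto_pow_atTop_nhds_zero_of_lt_one hq0 hq1).const_mul (C ^ 2)
  have hnn : ∀ n : ℕ, 0 ≤ physWeight 1 ε₀ ^ n * v n ^ 2 := fun n => by
    have hw0 : 0 ≤ physWeight 1 ε₀ := by rw [physWeight_one_rpow hε]; positivity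
    positivity
  exact squeeze_zero hnn (fun n => weightedWake_le_geometric hε hv n) hgeom

/-- **The exponent `s = 1/5` is the borderline**: the terminal profile `v_n = Λ^{4n/5} = (1+ε₀)^{2n}` (regularity class
exactly `s = 1/5`) has CONSTANT a=1-weighted wake `physWeight(1)^n v_n² = 1` — no decay.  (The (S₁) survival weight is the
`k_n^{1/5}`-class of the chain at base `Λ`; Barbato–Morandin's invariant region at `β = 5/2` is exactly this class.)
[cite: Tao2016AveragedNS, §4 (4.1), §6.4; Barbato–Morandin arXiv:1201.2693 Thm. 10 ff. (the class `k_n^{1/3-1/(3β)}`) for the comparison] -/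
theorem borderline_weightedWake_const (hε : 0 < ε₀) (n : ℕ) :
    physWeight 1 ε₀ ^ n * ((1 + ε₀) ^ (2 * n)) ^ 2 = 1 := by
  have hb : (0 : ℝ) < 1 + ε₀ := by linarith
  have hb' : (1 + ε₀ : ℝ) ≠ 0 := hb.ne'
  rw [physWeight_one_rpow hε]
  have h4 : ((1 + ε₀) ^ (-4 : ℝ)) = ((1 + ε₀) ^ 4)⁻¹ := by
    rw [Real.rpow_neg hb.le]; norm_cast
  rw [h4, inv_pow, ← pow_mul, ← pow_mul]
  rw [show 2 * n * 2 = 4 * n by ring]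
  exact inv_mul_cancel₀ (pow_ne_zero _ hb')

/-- **(ρ0)|dyadic ⟸ supercritical terminal regularity of positive type-I ancient solutions (BY NAME on the dyadic
member).**  Fix `ε₀ > 0`.  Suppose every non-negative solution `V : ℤ → (-∞,0) → ℝ` of the chain in critical variables
`V̇_n = Λ V_{n-1}² − Λ⁻¹ V_n V_{n+1}` obeying the type-I bound `V_n(t) ≤ C/(-t)`, with uniformly integrable shells and shells
bounded near `0⁻`, has terminal values `v_n = lim_{t↑0} V_n(t)` in SOME regularity class beyond the (S₁) borderline:
`∃ s > 1/5, ∃ C', ∀ n ≥ 0, |v_n| ≤ C' Λ^{(1-s)n}`.  Then no admissible inviscid eternal solution of the dyadic member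
`dyadicTable` at scale ratio `1+ε₀` is forward (S₁)-surviving.
[cite: Tao2016AveragedNS, §1.2, §4 Thm. 4.2 (statement shape), §6.4; tree `dyadic_noSurviving_iff_classicalPos`] -/
theorem dyadic_noSurviving_of_terminalRegularity (hε : 0 < ε₀)
    (hreg : ∀ V : ℤ → ℝ → ℝ,
      (∀ (n : ℤ) (t : ℝ), t < 0 →
        HasDerivAt (V n) (bigLam ε₀ * V (n - 1) t ^ 2 - (bigLam ε₀)⁻¹ * (V n t * V (n + 1) t)) t) →
      (∀ (n : ℤ) (t : ℝ), t < 0 → 0 ≤ V n t) →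
      (∃ C : ℝ, ∀ (n : ℤ) (t : ℝ), t < 0 → V n t ≤ C / (-t)) →
      (∃ M : ℝ, ∀ n : ℤ, IntegrableOn (fun t => |V n t|) (Iio 0) ∧ ∫ t in Iio 0, |V n t| ≤ M) →
      (∀ n : ℤ, ∃ t₀ : ℝ, t₀ < 0 ∧ ∃ P : ℝ, ∀ t : ℝ, t₀ ≤ t → t < 0 → |V n t| ≤ P) →
      ∀ v : ℤ → ℝ, (∀ n : ℤ, Tendsto (V n) (𝓝[<] 0) (𝓝 (v n))) →
        ∃ s : ℝ, 1 / 5 < s ∧ ∃ C' : ℝ, ∀ n : ℕ, |v n| ≤ C' * bigLam ε₀ ^ ((1 - s) * n)) :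
    ∀ W : ℤ → ℝ → Em 4, IsEternal ε₀ dyadicTable W → ¬ EternalSurvivingFwd 1 ε₀ W := by
  refine (dyadic_noSurviving_iff_classicalPos hε).2 ?_
  intro V hV hpos hI hact hbd v hv
  obtain ⟨s, hs, C', hC'⟩ := hreg V hV hpos hI hact hbd v hv
  exact tendsto_weightedWake_of_terminalRegularity hε hs hC'

end TerminalRegularity

end Summit.NavierStokesRegularity.NavierStokesRegularity.Theorems.NoSurvivingEternalViscBddOne.WakeCriterion

end
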